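import Summits.BirchSwinnertonDyer.BirchSwinnertonDyer.Theorems.ByReductionTypeAtTwoRankOneAtTwoBigImageOddLocalOneDoorHalvesJoint
import Summits.BirchSwinnertonDyer.BirchSwinnertonDyer.Theorems.ByReductionTypeAtTwoRankOneAtTwoBigImageOddLocalOneDoorHalvesJointDoor
import HarnessLib

/-!
# Route ByReductionTypeAtTwo, crux `RankOneAtTwoBigImageOddLocal` (stmt-BirchSwinnertonDyer-23715), LINE v8.6 `one_door_analytic`:
# the inter-route bridge, L-side — 22137's REGISTERED K-side LOWER stub + Kolyvagin's conjecture at `2` + the Manin stub ⟹ AN-28c-L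

Width prover seat `bsd-line-fkl-p2` g9 (2026-08-28), `--supports stmt-BirchSwinnertonDyer-23715`.  THEOREMS ONLY; nothing is asserted;
BSD is not proved by any of this.  Companion of `…OneDoorHalvesJointCrossed.lean` §8 (the U-side bridge
`doorIndexLawUpperCAtTwo_of_upperBoundAtTwo_uncorrected_of_manin`: 22137's registered `stub_upperBoundAtTwo` + `S_manin` ⟹ U mod PRINT).

`doorIndexLawLowerCAtTwo_of_lowerBoundAtTwo_uncorrected_of_kolyvaginConjecture_of_manin`: route GenusKolyvaginAtTwo's REGISTERED
`stub_lowerBoundAtTwo` of crux `KolyvaginExactAtTwo` (stmt-22137; signature VERBATIM: McCallum's lower bound `4^{M₀} ∣ #Ш(E_K)[2^∞]` from a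
`2`-indivisible derived point `P(n)` over a square-free product of Kolyvagin primes at `2`, no `c`-correction) + Kolyvagin's conjecture at
`2` on the slice's doors at odd-constant data (`hKC`, g7's binder verbatim, p622543) + `S_manin` (PRINT at `4 ∤ N`) ⟹ L =
`DoorIndexLawLowerCAtTwo`, modulo Gross–Zagier, Kolyvagin, GZK, modularity, Milne 1972 — and NO `S_rankZeroTwin` (the lead g10's announced
wiring «L ⟸ stub_lowerBoundAtTwo + Kolyvagin's conjecture + S_manin» carried the rank-`0` input; by the JOINT layer it is not needed).
Mechanism: at an odd-constant datum the uncorrected bound is the c-corrected one = the lower half over `K`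
(`lowerOverC_baseChange_two_iff_shaLowerC_at`), which is datum-free, hence the joint lower half of every door pair
(`jointLowerBoundAt_of_lowerOverC`), hence L's inequality at every datum (`jointLowerBoundAt_two_iff_doorLawLeC_at`).

So, modulo PRINT + `S_manin` (+ Kolyvagin's conjecture at `2` for L), the two registered K-side stubs of 22137 close the two half-children
of 23715 half by half; conversely U / L give back the c-corrected K-side halves on the doors (`…OneDoorHalvesJointSlice.lean` §6).

References: [GrossLMS1991] §2 Conj. (2.2), §4; [McCallumLMS1991] §5; [KolyvaginEulerSystems1990] Thm. A; [Milne1972ArithmeticAV] §1 Thm. 1;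
[Cesnavicius2018] Thm. 1.2; [WZhang2014] §3.7 (Kolyvagin's conjecture); [Miller2011LMS] Def. 1.1.
-/

set_option autoImplicit false
-- the Theorems namespace of this sub repeats the summit name by design (D-0017 nested layout)
set_option linter.dupNamespace false

noncomputable section

open scoped Classical

namespace Summit.BirchSwinnertonDyer.BirchSwinnertonDyer.Theorems.RankOneAtTwoOneDoor

open WeierstrassCurve NumberField Literature.NumberTheory.EllipticCurves Literature.NumberTheory.EllipticCurves.ModularForms
  Literature.NumberTheory.EllipticCurves.Rank1Residual
  Literature.NumberTheory.EllipticCurves.Rank1Residual.Typed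
  Literature.NumberTheory.EllipticCurves.KrizLi2019
  Summit.BirchSwinnertonDyer.Rank1Residual
  Summit.BirchSwinnertonDyer.Rank1Residual.AdditivePotMult
  Summit.BirchSwinnertonDyer.Rank1Residual.F1Sign2
  Summit.BirchSwinnertonDyer.Rank1Residual.F1Sign2.TranspositionDoor
  Summit.BirchSwinnertonDyer.BirchSwinnertonDyer.Theses.ByReductionTypeAtTwo
  Summit.BirchSwinnertonDyer.BirchSwinnertonDyer.Theorems.CMExactDescent
  Summit.BirchSwinnertonDyer.BirchSwinnertonDyer.Theorems.SchneiderFree.Upper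

/-! ### §10 The inter-route bridge, L-side: 22137's registered K-side LOWER stub + Kolyvagin's conjecture at `2` + the Manin stub ⟹ L -/

/-- **AN-28c-L from the REGISTERED `stub_lowerBoundAtTwo` of crux `KolyvaginExactAtTwo` (stmt-22137, route GenusKolyvaginAtTwo;
signature VERBATIM as binder `hX`: McCallum's lower bound `4^{M₀} ∣ #Ш(E_K)[2^∞]` from a `2`-INDIVISIBLE DERIVED POINT `P(n)`, no
`c`-correction), Kolyvagin's conjecture at `2` on the slice's Kolyvagin-admissible doors at odd-constant data (`hKC`, g7's binder
VERBATIM, p622543) and the odd-constant datum `S_manin`, modulo PRINT.**  At an odd-constant datum the uncorrected lower bound IS the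
c-corrected one, which is the lower half over `K` (§3), which is datum-free, so it is the joint lower half of every door pair (§1) and
hence L's inequality at every datum of the door (§2).  No `S_rankZeroTwin`.  Conditional by design; BSD is not proved by this.
[cite: GrossLMS1991, §2 Conj. (2.2) and §4] [cite: McCallumLMS1991, §5] [cite: Cesnavicius2018, Thm. 1.2] -/
theorem doorIndexLawLowerCAtTwo_of_lowerBoundAtTwo_uncorrected_of_kolyvaginConjecture_of_manin
    (hGZ : ∀ (N : ℕ) [NeZero N] (W : WeierstrassCurve ℚ) (K : Type) [Field K] [NumberField K], gross_zagier N W K)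
    (hKo : ∀ (N : ℕ) [NeZero N] (W : WeierstrassCurve ℚ) (K : Type) [Field K] [NumberField K], kolyvagin N W K)
    (hGZK : rank_eq_analyticRank_of_analyticRank_le_one) (hnf : exists_isNewformOf)
    (hMilneC : Milne1972.bsdQuotient_baseChange_quadratic_anyModel)
    (hX : ∀ (W : WeierstrassCurve ℚ) [W.IsElliptic] [W.IsGloballyMinimal] [NeZero (W.conductorNorm ℤ)], ¬ W.HasCM →
      ∀ (K : Type) [Field K] [NumberField K], IsImaginaryQuadratic K → Odd (NumberField.discr K) → NumberField.discr K ≠ -3 →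
      SatisfiesHeegnerHypothesis (W.conductorNorm ℤ) K → ¬ IsSquare ((NumberField.discr K : ℚ) * -|W.Δ|) →
      ¬ IsSquare ((NumberField.discr K : ℚ) * (-(2 * |W.Δ|))) → (∀ n : ℕ, 0 < n → W.HasSurjectiveModNGaloisRep ((2 : ℤ) ^ n)) →
      ∀ (Dt : ModularParametrizationData W (W.conductorNorm ℤ)) (β : ℤ) (ι : K →+* ℂ) (d₁ : KolyvaginHeegnerData Dt β ι 1),
      ¬ IsOfFinAddOrder d₁.derivedPoint → ∀ (M₀ : ℕ),
      (∃ Q : (W.baseChange (ringClassField K ι 1)).toAffine.Point, ((2 ^ M₀ : ℕ) : ℤ) • Q = d₁.derivedPoint) →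
      ∀ (n : ℕ) (d : KolyvaginHeegnerData Dt β ι n), Squarefree n →
      (∀ ℓ ∈ n.primeFactors, Zhang2014.IsKolyvaginPrime (W.conductorNorm ℤ) W K 2 ℓ) →
      (¬ ∃ Q : (W.baseChange (ringClassField K ι n)).toAffine.Point, (2 : ℤ) • Q = d.derivedPoint) →
      2 ^ (2 * M₀) ∣ Nat.card (AddCommGroup.primaryComponent (W.baseChange K).sha 2))
    (hKC : ∀ (W : WeierstrassCurve ℚ) [W.IsElliptic] [W.IsGloballyMinimal] [NeZero (W.conductorNorm ℤ)],
      ¬ W.HasCM → (∀ n : ℕ, W.HasSurjectiveModNGaloisRep ((2 ^ n : ℕ) : ℤ)) → Odd W.tamagawaProduct → W.analyticRank = 1 →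
      ∀ (K : Type) [Field K] [NumberField K], IsImaginaryQuadratic K → Odd (NumberField.discr K) →
        NumberField.discr K ≠ -3 → SatisfiesHeegnerHypothesis (W.conductorNorm ℤ) K →
        ¬ IsSquare ((NumberField.discr K : ℚ) * -|W.Δ|) → ¬ IsSquare ((NumberField.discr K : ℚ) * (-(2 * |W.Δ|))) →
        ∀ (Dt : ModularParametrizationData W (W.conductorNorm ℤ)) (β : ℤ) (ι : K →+* ℂ) (d₁ : KolyvaginHeegnerData Dt β ι 1),
          Odd Dt.c → ¬ IsOfFinAddOrder d₁.derivedPoint →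
          ∃ (n : ℕ) (d : KolyvaginHeegnerData Dt β ι n), Squarefree n ∧
            (∀ ℓ ∈ n.primeFactors, Zhang2014.IsKolyvaginPrime (W.conductorNorm ℤ) W K 2 ℓ) ∧
            ¬ ∃ Q : (W.baseChange (ringClassField K ι n)).toAffine.Point, (2 : ℤ) • Q = d.derivedPoint)
    (hMan : S_manin) : DoorIndexLawLowerCAtTwo := by
  intro W _ _ _ hCM hsurj hT hc hr K _ _ hK hadm hLt Dt H ι P hP Wd _ _ Cd hWd m hm
  haveI : Fact (Nat.Prime 2) := ⟨Nat.prime_two⟩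
  have hmod : hasEntireLFunction_rat := hasEntireLFunction_rat_of_exists_isNewformOf hnf
  have h2 : Module.finrank ℚ K = 2 := hK.1
  obtain ⟨hodd, h3, hsq1, hsq2⟩ := kolyvaginAdmissible_of_doorAdmissible W hadm
  have hH : SatisfiesHeegnerHypothesis (W.conductorNorm ℤ) K := satisfiesHeegnerHypothesis_of_doorAdmissible W K hK hadm
  have hρ : ∀ n : ℕ, 0 < n → W.HasSurjectiveModNGaloisRep ((2 : ℤ) ^ n) := fun n _ => by
    have h := hsurj n
    push_cast at h
    exact h
  have hρ2 : W.HasSurjectiveModNGaloisRep 2 := by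
    have h := hρ 1 one_pos
    rwa [pow_one] at h
  -- an odd-constant datum, a conductor-`1` Kolyvagin–Heegner datum over it, a `2`-indivisible derived point
  obtain ⟨Dt₀, hc₀⟩ := hMan W (noRationalTwoTorsion_of_odd_torsionOrder W hT)
  have hcM : Odd Dt₀.c := Int.not_even_iff_odd.mp fun h => hc₀ (even_iff_two_dvd.mp h)
  obtain ⟨β, d₁, M₀, hy, hdiv, hndiv⟩ := exists_kolyvaginDatum_at_door hmod W hr K hK (hGZ _ W K) hH hLt Dt₀ ι
  obtain ⟨n, d, hn, hKoly, hPn⟩ := hKC W hCM hsurj hc hr K hK hodd h3 hH hsq1 hsq2 Dt₀ β ι d₁ hcM hy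
  have hdvd := hX W hCM K hK hodd h3 hH hsq1 hsq2 hρ Dt₀ β ι d₁ hy M₀ hdiv n d hn hKoly hPn
  -- `Ш(E_K)` is finite (Gross–Zagier + GZK), so the divisibility is a valuation inequality
  obtain ⟨hrd, hrK⟩ := analyticRank_twin_and_baseChange_of_rankOne W K Dt₀ β ι d₁ Wd (hGZ _ W K) hmod hK hH hr hy ⟨Cd, hWd⟩
  obtain ⟨hfinK, -, -⟩ := exists_shaAnOverC_baseChange_padicValRat_eq_C W K Dt₀ β ι d₁ (hGZ _ W K) hGZK hmod hρ2 hc hK hodd h3 hH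
    hrK hdiv hndiv
  haveI := hfinK
  haveI : Finite (AddCommGroup.primaryComponent (W.baseChange K).sha 2) := Finite.of_injective _ Subtype.val_injective
  have hcard0 : Nat.card (AddCommGroup.primaryComponent (W.baseChange K).sha 2) ≠ 0 := Nat.card_pos.ne'
  have hle : 2 * M₀ ≤ padicValNat 2 (Nat.card (AddCommGroup.primaryComponent (W.baseChange K).sha 2)) :=
    (padicValNat_dvd_iff_le hcard0).mp hdvd
  have hshaL : 2 * (M₀ : ℤ) ≤ (padicValNat 2 (Nat.card (AddCommGroup.primaryComponent (W.baseChange K).sha 2)) : ℤ) +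
      2 * padicValInt 2 Dt₀.c := by
    rw [padicValInt.eq_zero_of_not_dvd hc₀]
    push_cast
    exact_mod_cast hle
  have hKL : MissingLowerBoundOverCAt (W.baseChange K) 2 :=
    (lowerOverC_baseChange_two_iff_shaLowerC_at W K Dt₀ β ι d₁ (hGZ _ W K) hGZK hmod hρ2 hc hK hodd h3 hH hrK hdiv hndiv).mpr hshaL
  -- datum-free ⟹ joint lower half of the pair ⟹ L's inequality at the GIVEN datum `Dt`
  haveI hEK : (W.baseChange K).IsElliptic := isElliptic_baseChange' W K
  obtain ⟨-, hfinW⟩ := hGZK W hr.le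
  obtain ⟨-, hfinD⟩ := hGZK Wd (by rw [hrd]; exact zero_le_one)
  have hV : ∃ C : VariableChange K, C • W.baseChange K = W.baseChange K := ⟨1, one_smul _ _⟩
  obtain ⟨hshaK, hWR⟩ := hMilneC W K h2 Wd ⟨Cd, hWd⟩ (W.baseChange K) hV hfinW hfinD
  obtain ⟨-, -, -, -, q, q', hq, hq', -⟩ :=
    doorPairLedger_package_at W hT hc hr K hK (hGZ _ W K) (hKo _ W K) hadm hLt Dt H ι P hP Wd Cd hWd hnf hGZK
  have hJ : JointLowerBoundAt W Wd 2 :=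
    jointLowerBoundAt_of_lowerOverC W 2 K Wd (W.baseChange K) hmod h2 ⟨Cd, hWd⟩ hV hfinW hfinD hshaK hWR hKL ⟨q', hq'⟩
  exact (jointLowerBoundAt_two_iff_doorLawLeC_at W hT hc hr K hK (hGZ _ W K) (hKo _ W K) hadm hLt Dt H ι P hP Wd Cd hWd hnf hGZK).mp
    hJ m hm

end Summit.BirchSwinnertonDyer.BirchSwinnertonDyer.Theorems.RankOneAtTwoOneDoor

end
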